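import Summits.FinalStateConjecture.FinalStateConjecture.Theorems.PhotonSphereChannelsTameEternalLimitDefs
import Mathlib.Geometry.Manifold.IntegralCurve.Basic
import Mathlib.Analysis.Calculus.Deriv.MeanValue
import HarnessLib

/-!
# Crux `ChannelsResolveTameDevelopmentsR` (stmt-FinalStateConjecture-14075), line
# `trapped-set-observability-analyticity` — stub `stub_kappaFloor` (S2): the red-shift predicate
# excludes cold (degenerate) horizons, and is met by constant positive surface gravity

Audit lemmas for the conclusion `∃ κ₀ > 0, E.RedShifted κ₀` of stub S2 (`stub_kappaFloor`, the
κ-floor), over the landed vocabulary `Theorems.TrappedSet`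
(`PhotonSphereChannelsTameEternalLimitDefs.lean`: `TameEternalLimit`, `.horizon`, `.RedShifted`).
`E.RedShifted κ₀` asks for a renormalisation `L' = φ L` of the clock-normalised generator field
`L` of the limit horizon `𝓗` — `φ` smooth near `𝓗` and pinched in `[c⁻¹, c]` on `𝓗` — with
CONSTANT non-affinity `∇_{L'} L' = κ₀ L'` on `𝓗`.  This file proves, with the tree's honest
Levi-Civita connection (`PseudoRiemannianMetric.leviCivita`, Leibniz rule from Mathlib's
`IsCovariantDerivativeOn.leibniz`):

* §1 generator calculus: on `𝓗` the generator does not vanish (`dt(L) = 1`), `L` is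
  differentiable there, the Leibniz expansion
  `∇_v (φ L) = φ ∇_v L + dφ(v) L` (`leviCivita_smul_L`), and the chain rule
  `(φ ∘ γ)' = dφ(L)` along an integral curve `γ` of `L` (`hasDerivAt_comp_of_isMIntegralCurve`);
* §2 THE TRANSPORT EQUATION behind `RedShifted` (docstring of `TameEternalLimit.RedShifted`:
  "`Lφ + κφ = κ₀`"): if `E.RedShifted κ₀` is witnessed by `φ` and the generator is pregeodesic at
  a horizon point, `∇_L L = k L`, then `dφ(L) = κ₀ − φ k` there (`mvfderiv_eq_of_redShifted_witness`);
* §3 NO COLD RED-SHIFTED HORIZON: if along ONE complete generator `γ` (an integral curve of `L`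
  through a horizon point — it stays on `𝓗`, `generator_tangent`) the clock-normalised
  non-affinity is `≤ 0` (`∇_L L = k L`, `k ≤ 0`; the degenerate case is `k = 0`: extremal Kerr
  with its Killing clock, `Kerr.IsExtremal.surfaceGravity_eq_zero`), then `E.RedShifted κ₀` fails
  for every `κ₀ > 0` (`not_redShifted_of_inaffinity_nonpos`): `φ ∘ γ` would satisfy
  `(φ ∘ γ)' = κ₀ − (φ ∘ γ) k ≥ κ₀ > 0` on all of `ℝ`, hence grow at least linearly (mean value
  theorem, `mul_sub_le_image_sub_of_le_deriv`), contradicting the pinching `φ ≤ c`.  So the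
  conclusion of S2 has content on every limit with nonempty horizon and is NOT obtainable from
  junk values of `leviCivita`; registered sub-goal `stub_notRedShiftedOfColdGenerator`;
* §4 CONSTANT POSITIVE SURFACE GRAVITY IS RED-SHIFTED: if `∇_L L = κ₀ L` at every horizon point
  (a Killing horizon generated by `L` with surface gravity `κ₀` in the clock `t`, e.g. exact
  sub-extremal Kerr, `κ₀ = √(M² − a²)/(r₊² + a²)`, `Kerr.surfaceGravity`), then `E.RedShifted κ₀`
  with `φ ≡ 1` (`redShifted_of_leviCivita_eq_smul`); registered sub-goal
  `stub_redShiftedOfConstantSurfaceGravity`;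
* §5 the one-dimensional heart, vocabulary-free (`KappaFloorODE`): a real function with
  derivative `≥ κ₀ > 0` everywhere is not pinched between two positive constants
  (`not_pinched_of_le_deriv`, `not_pinched_of_hasDerivAt_const`), while for a constant
  non-affinity `κ > 0` the constant `κ₀/κ` is a pinched solution of `φ' + κ φ = κ₀`
  (`pinched_solution_const`); registered sub-goal `stub_noPinchedLinearGrowth`.

These are the Lean form of the sentence "a degenerate (cold) horizon admits no such `φ` (`φ` would
grow linearly)" in the docstring of `RedShifted`, i.e. the dynamical-third-law content that S2 must
supply is exactly a POSITIVE FLOOR for the clock-normalised non-affinity along the limit horizon.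
-/

set_option linter.dupNamespace false

noncomputable section

namespace Summit.FinalStateConjecture.FinalStateConjecture.Theorems.TrappedSet

open Literature.Geometry.Lorentzian
open Bundle Set Manifold
open scoped Manifold ContDiff Topology

/-! ## §5 (stated first, used below) The one-dimensional heart -/

namespace KappaFloorODE

/-- **Linear growth is not pinched.** A differentiable `f : ℝ → ℝ` with `f' ≥ κ₀ > 0` everywhere
is not pinched between `c⁻¹` and `c` for any `c > 0`: by the mean value theorem
`f v − f 0 ≥ κ₀ v`, and `f 0 ≥ c⁻¹ > 0`, so `f (2c/κ₀) > c`. (The transport equation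
`φ' = κ₀ − κ φ` along a generator with non-affinity `κ ≤ 0` and `φ > 0` has `φ' ≥ κ₀`.) [folklore] -/
theorem not_pinched_of_le_deriv {κ₀ : ℝ} (hκ₀ : 0 < κ₀) {f : ℝ → ℝ} (hf : Differentiable ℝ f)
    (hf' : ∀ v, κ₀ ≤ deriv f v) {c : ℝ} (hc : 0 < c) :
    ¬ ∀ v, c⁻¹ ≤ f v ∧ f v ≤ c := by
  intro h
  have hv : (0 : ℝ) ≤ 2 * c / κ₀ := by positivity
  have hgrow := mul_sub_le_image_sub_of_le_deriv hf hf' hv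
  have h0 := (h 0).1
  have h1 := (h (2 * c / κ₀)).2
  have hc' : 0 < c⁻¹ := inv_pos.mpr hc
  have : κ₀ * (2 * c / κ₀ - 0) = 2 * c := by rw [sub_zero]; field_simp
  linarith

/-- The cold case: a solution of `φ' = κ₀` (`κ ≡ 0`, the transport equation on a DEGENERATE
generator) with `κ₀ > 0` is not pinched. [folklore] -/
theorem not_pinched_of_hasDerivAt_const {κ₀ : ℝ} (hκ₀ : 0 < κ₀) {f : ℝ → ℝ}
    (hf : ∀ v, HasDerivAt f κ₀ v) {c : ℝ} (hc : 0 < c) :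
    ¬ ∀ v, c⁻¹ ≤ f v ∧ f v ≤ c :=
  not_pinched_of_le_deriv hκ₀ (fun v ↦ (hf v).differentiableAt) (fun v ↦ by rw [(hf v).deriv]) hc

/-- The warm constant case: for a constant non-affinity `κ > 0` and `κ₀ > 0` the constant
`φ ≡ κ₀/κ` solves `φ' + κ φ = κ₀` and is pinched between `c⁻¹` and `c` for
`c = max (κ₀/κ) (κ/κ₀)`. [folklore] -/
theorem pinched_solution_const {κ κ₀ : ℝ} (hκ : 0 < κ) (hκ₀ : 0 < κ₀) :
    ∃ (φ : ℝ → ℝ) (c : ℝ), 0 < c ∧ (∀ v, HasDerivAt φ (κ₀ - κ * φ v) v) ∧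
      ∀ v, c⁻¹ ≤ φ v ∧ φ v ≤ c := by
  refine ⟨fun _ ↦ κ₀ / κ, max (κ₀ / κ) (κ / κ₀), lt_max_of_lt_left (div_pos hκ₀ hκ), ?_, ?_⟩
  · intro v
    have h : κ₀ - κ * (κ₀ / κ) = 0 := by field_simp; ring
    rw [h]
    exact hasDerivAt_const v _
  · intro v
    refine ⟨?_, le_max_left _ _⟩
    calc (max (κ₀ / κ) (κ / κ₀))⁻¹ ≤ (κ / κ₀)⁻¹ :=
          inv_anti₀ (div_pos hκ hκ₀) (le_max_right _ _)
      _ = κ₀ / κ := by rw [inv_div]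

end KappaFloorODE

/-- Registered sub-goal `stub_noPinchedLinearGrowth` (closed form of
`KappaFloorODE.not_pinched_of_le_deriv`): the one-dimensional reason a cold horizon is not
red-shifted. [folklore] -/
theorem stub_noPinchedLinearGrowth :
    ∀ κ₀ : ℝ, 0 < κ₀ → ∀ f : ℝ → ℝ, Differentiable ℝ f → (∀ v, κ₀ ≤ deriv f v) →
      ∀ c : ℝ, 0 < c → ¬ ∀ v, c⁻¹ ≤ f v ∧ f v ≤ c :=
  fun _ hκ₀ _ hf hf' _ hc ↦ KappaFloorODE.not_pinched_of_le_deriv hκ₀ hf hf' hc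

/-! ## §1 Generator calculus on a `TameEternalLimit` -/

namespace TameEternalLimit

variable (E : TameEternalLimit)

/-- On the horizon the clock-normalised generator does not vanish (`dt(L) = 1`). [folklore] -/
theorem L_ne_zero {p : E.Z.carrier} (hp : p ∈ E.horizon) : E.L p ≠ 0 := by
  intro h0
  have h1 := (E.generator_null p hp).2.2
  rw [h0, map_zero] at h1
  exact zero_ne_one h1

/-- On the horizon the generator field is differentiable as a section of `TZ` (it is `C^∞` on an
open neighbourhood of `𝓗`, `contMDiffOn_generator`). [folklore] -/
theorem mdifferentiableAt_L {p : E.Z.carrier} (hp : p ∈ E.horizon) :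
    MDifferentiableAt (𝓡 4) ((𝓡 4).prod 𝓘(ℝ, E4))
      (fun x ↦ (TotalSpace.mk' E4 x (E.L x) : TangentBundle (𝓡 4) E.Z.carrier)) p := by
  obtain ⟨𝒩, h𝒩, hsub, hL⟩ := E.contMDiffOn_generator
  exact ((hL.contMDiffAt (h𝒩.mem_nhds (hsub hp))).mdifferentiableAt (by simp))

/-- **Leibniz expansion of the renormalised generator**: at a horizon point, for `φ`
differentiable there, `∇_v (φ L) = φ(p) ∇_v L + dφ_p(v) L(p)` (Mathlib's
`IsCovariantDerivativeOn.leibniz` for the Levi-Civita connection). [folklore] -/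
theorem leviCivita_smul_L [E.Z.metric.toPseudoRiemannianMetric.HasLeviCivita]
    {φ : E.Z.carrier → ℝ} {p : E.Z.carrier} (hp : p ∈ E.horizon)
    (hφ : MDifferentiableAt (𝓡 4) 𝓘(ℝ, ℝ) φ p) (v : TangentSpace (𝓡 4) p) :
    E.Z.metric.leviCivita (fun x ↦ φ x • E.L x) p v =
      φ p • E.Z.metric.leviCivita E.L p v + mvfderiv (𝓡 4) φ p v • E.L p := by
  have h := (E.Z.metric.leviCivita.isCovariantDerivativeOn (s := Set.univ)).leibniz
    (E.mdifferentiableAt_L hp) hφ (Set.mem_univ p)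
  have h' := DFunLike.congr_fun h v
  exact h'

-- `TangentSpace 𝓘(ℝ, ℝ) s` is definitionally `ℝ`; reading the manifold derivative of the real
-- function `φ ∘ γ` as an ordinary derivative moves across this identification, exactly as Mathlib's
-- `IsMIntegralCurveAt.eventually_hasDerivAt` does (same option, same proof pattern; adapted from
-- `Literature.Geometry.Lorentzian.LorentzianMetric.monotoneOn_comp_of_isMIntegralCurveOn`).
set_option backward.isDefEq.respectTransparency false in
/-- **Chain rule along a generator**: if `γ` is an integral curve of `L` and `φ` is differentiable
at `γ s`, then `φ ∘ γ` has derivative `dφ_{γ s}(L (γ s))` at `s`. [folklore] -/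
theorem hasDerivAt_comp_of_isMIntegralCurve {γ : ℝ → E.Z.carrier} (hγ : IsMIntegralCurve γ E.L)
    {φ : E.Z.carrier → ℝ} (s : ℝ) (hφ : MDifferentiableAt (𝓡 4) 𝓘(ℝ, ℝ) φ (γ s)) :
    HasDerivAt (φ ∘ γ) (mvfderiv (𝓡 4) φ (γ s) (E.L (γ s))) s := by
  rw [hasDerivAt_iff_hasFDerivAt, ← hasMFDerivAt_iff_hasFDerivAt]
  apply (hφ.hasMFDerivAt.comp s (hγ s)).congr_mfderiv
  rw [ContinuousLinearMap.ext_iff]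
  intro r
  rw [ContinuousLinearMap.comp_apply, ContinuousLinearMap.smulRight_apply, map_smul]
  rfl

/-! ## §2 The transport equation behind `RedShifted` -/

/-- **The transport equation.** If `φ` witnesses the non-affinity clause of `E.RedShifted κ₀` at a
horizon point `p` (`∇_{φL}(φL) = κ₀ φ L` at `p`, `φ p ≠ 0`, `φ` differentiable at `p`) and the
generator is pregeodesic there, `∇_{L p} L = k L p`, then `dφ_p(L p) = κ₀ − φ(p) k`: the equation
`Lφ + κφ = κ₀` of the docstring of `TameEternalLimit.RedShifted`. [folklore] -/
theorem mvfderiv_eq_of_redShifted_witness [E.Z.metric.toPseudoRiemannianMetric.HasLeviCivita]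
    {φ : E.Z.carrier → ℝ} {p : E.Z.carrier} (hp : p ∈ E.horizon)
    (hφ : MDifferentiableAt (𝓡 4) 𝓘(ℝ, ℝ) φ p) (hφp : φ p ≠ 0) {k κ₀ : ℝ}
    (hk : E.Z.metric.leviCivita E.L p (E.L p) = k • E.L p)
    (heq : E.Z.metric.leviCivita (fun x ↦ φ x • E.L x) p (φ p • E.L p) = κ₀ • (φ p • E.L p)) :
    mvfderiv (𝓡 4) φ p (E.L p) = κ₀ - φ p * k := by
  rw [E.leviCivita_smul_L hp hφ] at heq
  simp only [map_smul, hk, smul_smul, ← add_smul, smul_eq_mul] at heq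
  have h2 := smul_left_injective ℝ (E.L_ne_zero hp) heq
  have h3 : φ p * (φ p * k + mvfderiv (𝓡 4) φ p (E.L p) - κ₀) = 0 := by linear_combination h2
  have h4 := (mul_eq_zero.mp h3).resolve_left hφp
  linarith

/-! ## §3 No cold red-shifted horizon -/

/-- **A horizon with a cold (or anti-damped) complete generator is not red-shifted.**  Let `γ` be
an integral curve of the generator field `L` through a horizon point (a complete generator,
`generator_complete`; it stays on `𝓗`, `generator_tangent`) along which `L` is pregeodesic with
clock-normalised non-affinity `k ≤ 0` — the degenerate case being `k = 0`, e.g. extremal Kerr with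
its Killing clock (`Kerr.IsExtremal.surfaceGravity_eq_zero`).  Then `E.RedShifted κ₀` fails for
every `κ₀ > 0`: a witness `φ` would satisfy `(φ ∘ γ)' = κ₀ − (φ ∘ γ) k ≥ κ₀` on `ℝ`
(`mvfderiv_eq_of_redShifted_witness`, `φ > 0` on `𝓗`), hence grow linearly, contradicting
`φ ≤ c` (`KappaFloorODE.not_pinched_of_le_deriv`).  This is the sentence "a degenerate (cold)
horizon admits no such `φ`" of the docstring of `RedShifted`; Wald 1984, §12.5 (the affinely
parametrised generator has `κ = 0`). [cite: Wald1984, §12.5] -/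
theorem not_redShifted_of_inaffinity_nonpos [E.Z.metric.toPseudoRiemannianMetric.HasLeviCivita]
    {γ : ℝ → E.Z.carrier} (hγ : IsMIntegralCurve γ E.L) (h0 : γ 0 ∈ E.horizon)
    (hk : ∀ s, ∃ k : ℝ, k ≤ 0 ∧ E.Z.metric.leviCivita E.L (γ s) (E.L (γ s)) = k • E.L (γ s))
    {κ₀ : ℝ} (hκ₀ : 0 < κ₀) : ¬ E.RedShifted κ₀ := by
  rintro ⟨φ, c, hc, ⟨𝒩, h𝒩, hsub, hφ⟩, hpinch, heq⟩
  have hmem : ∀ s, γ s ∈ E.horizon := E.generator_tangent γ hγ h0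
  have hφd : ∀ s, MDifferentiableAt (𝓡 4) 𝓘(ℝ, ℝ) φ (γ s) := fun s ↦
    (hφ.contMDiffAt (h𝒩.mem_nhds (hsub (hmem s)))).mdifferentiableAt (by simp)
  have hφpos : ∀ s, 0 < φ (γ s) := fun s ↦
    lt_of_lt_of_le (inv_pos.mpr hc) (hpinch _ (hmem s)).1
  -- the derivative of `φ ∘ γ`
  have hder : ∀ s, HasDerivAt (φ ∘ γ) (mvfderiv (𝓡 4) φ (γ s) (E.L (γ s))) s := fun s ↦
    E.hasDerivAt_comp_of_isMIntegralCurve hγ s (hφd s)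
  -- the transport equation makes it `≥ κ₀`
  have hge : ∀ s, κ₀ ≤ mvfderiv (𝓡 4) φ (γ s) (E.L (γ s)) := by
    intro s
    obtain ⟨k, hk0, hkeq⟩ := hk s
    rw [E.mvfderiv_eq_of_redShifted_witness (hmem s) (hφd s) (hφpos s).ne' hkeq
      (heq _ (hmem s))]
    nlinarith [hφpos s]
  have hdiff : Differentiable ℝ (φ ∘ γ) := fun s ↦ (hder s).differentiableAt
  have hge' : ∀ s, κ₀ ≤ deriv (φ ∘ γ) s := fun s ↦ by rw [(hder s).deriv]; exact hge s
  exact KappaFloorODE.not_pinched_of_le_deriv hκ₀ hdiff hge' hc fun s ↦ hpinch _ (hmem s)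

/-- Corollary (the degenerate case): if some horizon point lies on a complete generator along
which `L` is affinely parametrised, `∇_L L = 0`, then `¬ E.RedShifted κ₀` for every `κ₀ > 0`.
[folklore] -/
theorem not_redShifted_of_affine_generator [E.Z.metric.toPseudoRiemannianMetric.HasLeviCivita]
    {γ : ℝ → E.Z.carrier} (hγ : IsMIntegralCurve γ E.L) (h0 : γ 0 ∈ E.horizon)
    (hgeod : ∀ s, E.Z.metric.leviCivita E.L (γ s) (E.L (γ s)) = 0)
    {κ₀ : ℝ} (hκ₀ : 0 < κ₀) : ¬ E.RedShifted κ₀ :=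
  E.not_redShifted_of_inaffinity_nonpos hγ h0
    (fun s ↦ ⟨0, le_rfl, by rw [hgeod s, zero_smul]⟩) hκ₀

/-! ## §4 Constant positive surface gravity is red-shifted -/

/-- **A horizon of constant surface gravity `κ₀` in the clock normalisation is `RedShifted κ₀`**,
with the trivial renormalisation `φ ≡ 1` (`c = 1`, `𝒩 = univ`): if `∇_{L p} L = κ₀ L p` at every
horizon point then `E.RedShifted κ₀`.  For the Killing generator `χ = ∂_t + Ω_H ∂_φ` of exact Kerr
and a clock with `χ t = 1` this `κ₀` is `Kerr.surfaceGravity M a = √(M² − a²)/(r₊² + a²)`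
(`= 1/(4M)` for `a = 0`), positive iff `|a| < M`; no sign hypothesis is needed here.  Wald 1984,
§12.5, (12.5.2). [cite: Wald1984, §12.5] -/
theorem redShifted_of_leviCivita_eq_smul [E.Z.metric.toPseudoRiemannianMetric.HasLeviCivita]
    {κ₀ : ℝ} (h : ∀ p ∈ E.horizon, E.Z.metric.leviCivita E.L p (E.L p) = κ₀ • E.L p) :
    E.RedShifted κ₀ := by
  refine ⟨fun _ ↦ 1, 1, one_pos, ⟨Set.univ, isOpen_univ, Set.subset_univ _, contMDiffOn_const⟩,
    fun p _ ↦ by simp, fun p hp ↦ ?_⟩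
  have h1 : (fun x ↦ (1 : ℝ) • E.L x) = E.L := funext fun x ↦ one_smul _ _
  rw [h1, one_smul, h p hp]

end TameEternalLimit

/-- Registered sub-goal `stub_notRedShiftedOfColdGenerator` (closed form of
`TameEternalLimit.not_redShifted_of_inaffinity_nonpos`): a `TameEternalLimit` with one complete
generator of non-positive clock-normalised non-affinity is not `RedShifted κ₀` for any `κ₀ > 0`.
[folklore] -/
theorem stub_notRedShiftedOfColdGenerator :
    ∀ (E : TameEternalLimit) [E.Z.metric.toPseudoRiemannianMetric.HasLeviCivita]
      (γ : ℝ → E.Z.carrier), IsMIntegralCurve γ E.L → γ 0 ∈ E.horizon →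
      (∀ s : ℝ, ∃ k : ℝ, k ≤ 0 ∧ E.Z.metric.leviCivita E.L (γ s) (E.L (γ s)) = k • E.L (γ s)) →
      ∀ κ₀ : ℝ, 0 < κ₀ → ¬ E.RedShifted κ₀ :=
  fun E _ _ hγ h0 hk _ hκ₀ ↦ E.not_redShifted_of_inaffinity_nonpos hγ h0 hk hκ₀

/-- Registered sub-goal `stub_redShiftedOfConstantSurfaceGravity` (closed form of
`TameEternalLimit.redShifted_of_leviCivita_eq_smul`): constant non-affinity `κ₀` on the horizon
gives `RedShifted κ₀` (witness `φ ≡ 1`). [folklore] -/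
theorem stub_redShiftedOfConstantSurfaceGravity :
    ∀ (E : TameEternalLimit) [E.Z.metric.toPseudoRiemannianMetric.HasLeviCivita] (κ₀ : ℝ),
      (∀ p ∈ E.horizon, E.Z.metric.leviCivita E.L p (E.L p) = κ₀ • E.L p) → E.RedShifted κ₀ :=
  fun E _ _ h ↦ E.redShifted_of_leviCivita_eq_smul h

end Summit.FinalStateConjecture.FinalStateConjecture.Theorems.TrappedSet

end
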